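import Summits.QuantumFields.BalabanUV.T4Continuum.Spine.NE7.QLaTorusIterate
import Summits.QuantumFields.BalabanUV.T4Continuum.Spine.NE7.QLaBondDeviationBridge
import Literature.MathematicalPhysics.QuantumFieldTheory.Balaban1983to89.BlockAveragingFederbush

/-!
# Spine/NE7/QLaTorusFramedBondLip — `FramedBondLip (avgB7 P N) dom (4e) L^{1−d}` PROVED: the per-entry Jacobian bound
# [Balaban1985Averaging] Prop. 5 (156) at `U₀ = 1` (b07, kernel) transported to the TORUS realisation of Bałaban's (15); hence
# `BondDevBound` ∕ `HolDevBound` ∕ `LoopDefectBound` (files 12 ∕ 8 ∕ 5) — NODE S's input chain closed end-to-end on Bałaban's own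
# averaging, for `G = U(N)`, on the small-field sup-ball domain

Cell `pub-balaban-gaps` (YM blitz Y1, track G2, seat `ne7`, generation 6); text of record
`run/shared/lean/pub/pub-balaban-gaps/ne/NE7.md` v6 §4septies, census rows R39 (BOTH halves now in kernel) ∕ R45 (fork (b-i) executed)
∕ R46 (the domain radius).  Twentieth `Spine/NE7/` file; imports file 19 (`QLaTorusIterate`), file 12 (`QLaBondDeviationBridge`:
`FramedBondLip`, `bondDevBound_of_framedBondLip`, `holDevBound_of_framedBondLip`; through it files 10∕8∕5: `theta`, `HolDevBound`,
`loopDefectBound_of_holDevBound`, `reTrCrit_unitaryGroup`) and pv26's `BlockAveragingFederbush` (`FederbushMean.norm_mlog_sub_mlog_le`: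
Lipschitz bound of the series logarithm), all consumed BY NAME.

THE CHAIN (what is now kernel, bottom to top): b07 `B7Prop5Flat.prop5_flat_156_B` (per-entry (156) at `U₀ = 1`) → file 14
`norm_dbavgIter_sub_le_one_bond` (one-bond Lipschitz of `U̿ⁿ` on `ℤ^d`) → THIS FILE `framed_lip` (clause (ii) on the torus) +
`framed_one` (clause (i)) → `framedBondLip_avgB7` → file 12 → `bondDevBound_avgB7` → `holDevBound_avgB7` → file 8∕5 (criticality of
`Re tr` on `U(N)`, `Cc = 1/2`) → `loopDefectBound_avgB7`: for every level `k`, every `n` with `k + n ≤ m + K`, every closed walk `w` of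
the coarse torus and every `V` in the domain, `0 ≤ 1 − W_w(avgB7ⁿ V) ≤ 8e²·(|w|·tv(1,V)·L^{(1−d)n})²`.

WHAT IS HERE (proof-only; the objects `rho`, `dom`, `logCfg`, `toG`, `frB7` are DEFINED in file 19 §5).  §1 the domain family
`dom P N k = {V : ∀ b, ‖V_b − 1‖ ≤ ρ_k}`, `ρ_k = 1/(2C₃(d,L)L^{m+K−k})` (so that the
logarithmic coordinates `B = log Ṽ`, `‖B‖ ≤ 2ρ_k`, satisfy b07's `C₃L^n(2ρ_k) ≤ 1` for every admissible `n`, `C3_smallness`);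
`fibreConvex_dom` (a sup-ball is closed under bondwise mixing), `one_mem_dom`.  §2 `logCfg`, `expCfg_logCfg` (`e^{log Ṽ} = Ṽ` on the
domain, b07's `expUnit_mlog`), `norm_logCfg_le` ((26): `‖log V‖ ≤ 2‖V − 1‖`).  §3 for the frame map `frB7 k n V = (g_n[Ṽ] ∘ tlift)⁻¹`
read in `U(N)` (`toG`): `per_add` (`T_k = T_{k+n}L^n`), `eq_of_inBox_of_tcls_eq` (two lifts of one torus point in a box narrower than the
period coincide), and `toUnits_framed`: `(avgB7ⁿ V)^{frB7 V}(c) = U̿ⁿ[Ṽ](tlift c₋, dir c)` — file 19's identity descended to the torus.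
§4 clause (i) `framed_one` (file 14's `dbavgIter_one`).  §5 `bdist_eq_norm_sub` (`bdist g h = ‖h − g‖` on `U(N)`: unitaries are
isometries), `K5_le` (`K5 ≤ θⁿ` under `C₃L^nb ≤ 1`), `rate_eq` (`L^n(L^n)^{−d} = θ^n`, `θ = L^{1−d}` = file 10's `theta`), and clause
(ii) `framed_lip`: `V, V′ ∈ dom k` differing at one torus bond `b₀` ⟹ every framed coarse bond variable moves by
`≤ 4e·θⁿ·bdist(V_{b₀}, V′_{b₀})` — the lifts differ on the periodic family of lifts of `b₀`, of which AT MOST ONE meets the box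
`B^n(c₋) ∪ B^n(c₊)` (side `2L^n ≤ T_k`; `eq_of_inBox_of_tcls_eq`), so file 14's one-bond bound applies to the intermediate
configuration switching that one lift, locality (b07's `logIter_congr`) identifies the rest, and `‖log V′ − log V‖ ≤ 2‖V′ − V‖`.
§6 the four named consequences.  §7 `abs_log_quotient_sub_le_avgB7`: the end-to-end log-quotient statement NODE S consumes (twin
of file 10's `abs_log_quotient_sub_le_linAvg`), for the genuine non-abelian (15).

HONEST FRAMING.  [folklore] bookkeeping; the analytic input is b07's KERNEL theorem (156) at the FLAT background `U₀ = 1` (the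
curved background `U₀ ≠ 1`, p06's `B7Prop5General`, would go the same way through file 16 — NOT done here); the averaging is fork
(b-i) «B7 (15), corner blocks, periodic lift, `G = U(N)`», NOT the averaging of record (0.4) of [Balaban1987RG1] (pv26's
`BlockAveraging.blockAvg`); the domain is a sup-ball of radius `ρ_k ~ C₃⁻¹L^{−(m+K−k)}` (Bałaban-style non-optimal constants; the
(1.100) radius of [Balaban1989LargeFieldI] is of this KIND, census R31∕R43, not matched numerically); the constant `4e` and `Cd = 8e²`
are not optimised.  NODE S = (QL-a)∣_{U=1} still consumes, besides this chain, NODE O's format (W-fmt@1) and the (0.26) census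
(NE7.md §8): (QL-a) NOT IN PRINT ([Balaban1989LargeFieldII] p. 356 defers observables); NE7 NOT proved; spine 0∕9; fixed finite T⁴ —
NOT ℝ⁴, NOT infinite volume, NOT a mass gap, NOT Clay.
-/

noncomputable section

open scoped BigOperators Matrix.Norms.L2Operator

namespace Summit.QuantumFields.BalabanUV.T4Continuum.Spine.NE7.TorusB7

open Literature.MathematicalPhysics.QuantumFieldTheory.Balaban1983to89
open Literature.MathematicalPhysics.QuantumFieldTheory.Balaban1983to89.B7Prop1Explicit hiding Site
open Literature.MathematicalPhysics.QuantumFieldTheory.Balaban1983to89.B7Prop1Local (InBox AgreeOn)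
open Literature.MathematicalPhysics.QuantumFieldTheory.Balaban1983to89.B7Prop2Explicit (unitaryUnits mem_unitaryUnits
  unitaryUnits_le_U1)
open Literature.MathematicalPhysics.QuantumFieldTheory.Balaban1983to89.B7Prop3Flat (expCfg)
open Literature.MathematicalPhysics.QuantumFieldTheory.Balaban1983to89.B7Prop4Flat (dbavgIter logIter
  dbavgIter_eq_expCfg_logIter expUnit_mlog C1_pos)
open Literature.MathematicalPhysics.QuantumFieldTheory.Balaban1983to89.B7Prop5Flat (C3 C3_pos K5 BondIn logIter_congr)
open Literature.MathematicalPhysics.QuantumFieldTheory.Balaban1983to89.MatrixLog (mlog norm_mlog_le_two_mul)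
open Literature.MathematicalPhysics.QuantumFieldTheory.Balaban1983to89.T4TermwiseTorus (tcls tcls_apply tcls_add tlift
  tcls_tlift IsPeriodic tcls_eq_tcls_iff)
open Literature.MathematicalPhysics.QuantumFieldTheory.Balaban1983to89.T4Continuum
open Literature.MathematicalPhysics.QuantumFieldTheory.Balaban1983to89.T4AvgSensitivity (iterFrom)
open Literature.MathematicalPhysics.QuantumFieldTheory.Balaban1983to89.T4AvgDerivBound (bdist bdist_def bdist_nonneg FibreConvex)
open Summit.QuantumFields.BalabanUV.T4Continuum.Spine.NE7.B7Flat (smallness_of_C3 norm_dbavgIter_sub_le_one_bond dbavgIter_one)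

variable {P : Params} {N : ℕ}

/-! ## §1 The small-field domain: a sup-ball of bond variables around `1`, radius `ρ_k = 1/(2C₃L^{m+K−k})` -/

/-- `1 ≤ C₃(d,L)`. [folklore] -/
theorem one_le_C3 (P : Params) : (1 : ℝ) ≤ C3 P.d P.L := by
  have h := C3_ge P
  have hL1 : (1 : ℝ) ≤ P.L := by exact_mod_cast P.L_pos
  have hd0 : (0 : ℝ) ≤ P.d := Nat.cast_nonneg _
  nlinarith
/-- `ρ_k > 0`. [folklore] -/
theorem rho_pos (P : Params) (k : ℕ) : 0 < rho P k := by
  have := one_le_C3 P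
  have hL : (0 : ℝ) < P.L := by exact_mod_cast P.L_pos
  unfold rho; positivity
/-- `ρ_k ≤ 1/2` (inside the domain of the series (21)). [folklore] -/
theorem rho_le_half (P : Params) (k : ℕ) : rho P k ≤ 1 / 2 := by
  have h1 := one_le_C3 P
  have hL1 : (1 : ℝ) ≤ P.L := by exact_mod_cast P.L_pos
  have hpow : (1 : ℝ) ≤ (P.L : ℝ) ^ (P.m + P.K - k) := one_le_pow₀ hL1
  unfold rho
  rw [div_le_div_iff₀ (by positivity) (by norm_num)]
  nlinarith

/-- b07's smallness for the domain radius: `C₃·(L^n·2ρ_k) ≤ 1` whenever `k + n ≤ m + K`. [folklore] -/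
theorem C3_smallness {k n : ℕ} (hkn : k + n ≤ P.m + P.K) : C3 P.d P.L * ((P.L : ℝ) ^ n * (2 * rho P k)) ≤ 1 := by
  have hC := C3_pos P.d P.L P.L_pos
  have hL1 : (1 : ℝ) ≤ P.L := by exact_mod_cast P.L_pos
  have hpow : (P.L : ℝ) ^ n ≤ (P.L : ℝ) ^ (P.m + P.K - k) := pow_le_pow_right₀ hL1 (by omega)
  have hpos : (0 : ℝ) < (P.L : ℝ) ^ (P.m + P.K - k) := by positivity
  unfold rho
  rw [show C3 P.d P.L * ((P.L : ℝ) ^ n * (2 * (1 / (2 * C3 P.d P.L * (P.L : ℝ) ^ (P.m + P.K - k)))))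
      = (P.L : ℝ) ^ n / (P.L : ℝ) ^ (P.m + P.K - k) by field_simp]
  rwa [div_le_one hpos]

/-- The domain family is FIBRE CONVEX (closed under bondwise mixing — a sup-ball; the tree's `T4AvgDerivBound.FibreConvex`). [folklore] -/
theorem fibreConvex_dom : FibreConvex (dom P N) := by
  intro j V V' W hV hV' hW b
  rcases hW b with h | h <;> rw [h]
  exacts [hV b, hV' b]

/-! ## §2 Logarithmic coordinates of the lift -/

/-- On the domain, `e^{log Ṽ} = Ṽ` bondwise ((21)–(22); b07's `expUnit_mlog`). [cite: Balaban1985Averaging, (21)–(22) p.21] -/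
theorem expCfg_logCfg {k : ℕ} {V : GaugeField P k (Matrix.unitaryGroup (Fin N) ℂ)} (hV : V ∈ dom P N k) :
    expCfg (logCfg V) = liftCfg V := by
  funext x κ
  refine expUnit_mlog ?_
  exact (hV _).trans_lt ((rho_le_half P k).trans_lt (by norm_num))

/-- On the domain, `‖log Ṽ_b‖ ≤ 2ρ_k` ((26): `‖log V‖ ≤ 2‖V − 1‖` for `‖V − 1‖ ≤ 1/2`). [cite: Balaban1985Averaging, (26) p.21] -/
theorem norm_logCfg_le {k : ℕ} {V : GaugeField P k (Matrix.unitaryGroup (Fin N) ℂ)} (hV : V ∈ dom P N k)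
    (x : Fin P.d → ℤ) (κ : Fin P.d) : ‖logCfg V x κ‖ ≤ 2 * rho P k :=
  (norm_mlog_le_two_mul ((hV _).trans (rho_le_half P k))).trans (by linarith [hV ⟨tcls (per P k) x, κ⟩])

/-- On the domain, `e^{log Ṽ}` is `U(N)`-valued. [folklore] -/
theorem liftCfg_mem_dom_unitary {k : ℕ} {V : GaugeField P k (Matrix.unitaryGroup (Fin N) ℂ)} (hV : V ∈ dom P N k)
    (x : Fin P.d → ℤ) (κ : Fin P.d) : expCfg (logCfg V) x κ ∈ unitaryUnits (Mat N) := by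
  rw [expCfg_logCfg hV]; exact liftCfg_mem V x κ

/-- `toG` is the identity on unitaries. [folklore] -/
theorem toUnits_toG {X : (Mat N)ˣ} (h : X ∈ unitaryUnits (Mat N)) : Unitary.toUnits (toG X) = X := by
  have h' : (X : Mat N) ∈ unitary (Mat N) := h
  apply Units.ext
  simp only [toG, dif_pos h']
  rfl

variable [NeZero N]

/-- The trivial configuration is in every domain. [folklore] -/
theorem one_mem_dom (j : ℕ) : (1 : GaugeField P j (Matrix.unitaryGroup (Fin N) ℂ)) ∈ dom P N j := fun b => by
  have : (((1 : GaugeField P j (Matrix.unitaryGroup (Fin N) ℂ)) b : Matrix.unitaryGroup (Fin N) ℂ) : Mat N) = 1 := rfl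
  rw [this, sub_self, norm_zero]; exact (rho_pos P j).le

/-! ## §3 The frame map: the inverse accumulated gauge transformation, read on the coarse torus -/

/-- `T_k = T_{k+n}·L^n` in the standing range. [cite: Balaban1987RG1, (0.1) p.251] -/
theorem per_add {k : ℕ} : ∀ {n : ℕ}, k + n ≤ P.m + P.K → per P k = per P (k + n) * P.L ^ n
  | 0, _ => by simp
  | n + 1, h => by
    rw [per_add (n := n) (by omega), per_succ (j := k + n) (by omega), pow_succ]
    simp only [Nat.add_assoc]
    ring

/-- Two points of a box narrower than the period with the same torus class coincide. [folklore] -/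
theorem eq_of_inBox_of_tcls_eq {T : ℕ} {lo hi x y : Fin P.d → ℤ} (hx : InBox lo hi x) (hy : InBox lo hi y)
    (hw : ∀ i, hi i - lo i < T) (h : tcls T x = tcls T y) : x = y := by
  obtain ⟨m, rfl⟩ := (tcls_eq_tcls_iff T).1 h
  have hm : ∀ i, m i = 0 := fun i => by
    have h1 := hx i; have h2 := hy i; have h3 := hw i
    simp only [Pi.add_apply, Pi.smul_apply, smul_eq_mul] at h2
    by_contra hmi
    rcases lt_or_gt_of_ne hmi with hneg | hpos
    · nlinarith
    · nlinarith
  have : m = 0 := funext hm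
  simp [this]

/-- **THE FRAMED ITERATE IS THE DOUBLE-BAR ITERATE**: for `V` in the domain, the coarse bond variable of `(avgB7ⁿ V)^{fr V}` at `c`
is `U̿ⁿ[Ṽ](tlift c₋, dir c)` — (159) p. 42 transported to the torus. [cite: Balaban1985Averaging, (159) p.42] -/
theorem toUnits_framed {k n : ℕ} (hkn : k + n ≤ P.m + P.K) {V : GaugeField P k (Matrix.unitaryGroup (Fin N) ℂ)}
    (hV : V ∈ dom P N k) (c : PBond P (k + n)) :
    Unitary.toUnits (GaugeField.gaugeAct (frB7 P N k n V) (iterFrom (avgB7 P N) k n V) c)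
      = dbavgIter P.L (liftCfg V) n (tlift c.src) c.dir := by
  have hsm := C3_smallness (P := P) hkn
  obtain ⟨-, hg, heq⟩ := citer_eq_gaugeAct_dbavgIter (P := P) (N := N) (liftCfg_mem_dom_unitary hV)
    (by linarith [rho_pos P k]) (norm_logCfg_le hV) hsm n le_rfl
  rw [expCfg_logCfg hV] at hg heq
  -- periodicity of the accumulated gauge on the coarse torus
  have hper : IsPeriodic (per P (k + n)) (gacc P N (liftCfg V) n) := by
    refine gacc_periodic n ?_
    rw [← per_add hkn]; exact liftCfg_periodic V
  have htgt : gacc P N (liftCfg V) n (tlift c.tgt) = gacc P N (liftCfg V) n (tlift c.src + e c.dir) :=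
    hper.eq_of_tcls_eq (by rw [tcls_tlift, tcls_add_e, tcls_tlift]; rfl)
  have hiter : Unitary.toUnits (iterFrom (avgB7 P N) k n V c) = citer P N (liftCfg V) n (tlift c.src) c.dir := by
    rw [← liftCfg_iterFrom V n hkn]
    simp only [liftCfg, tcls_tlift]
  simp only [GaugeField.gaugeAct, map_mul, map_inv, frB7, hiter, heq, htgt, gaugeAct,
    toUnits_toG ((unitaryUnits (Mat N)).inv_mem (hg _))]
  group

/-! ## §4 Clause (i): the framed average of the trivial configuration is trivial -/

omit [NeZero N] in
/-- `e^{0} = 1` bondwise. [folklore] -/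
theorem expCfg_zero : expCfg (0 : (Fin P.d → ℤ) → Fin P.d → Mat N) = 1 := by
  funext x κ
  apply Units.ext
  simp [expCfg]

/-- **CLAUSE (i) OF `FramedBondLip` FOR `avgB7`**: the framed `n`-fold average of the trivial configuration is trivial (file 14's `dbavgIter_one`: `U̿ⁿ[1] = 1`). [cite: Balaban1985Averaging, (90)–(91) p.31] -/
theorem framed_one {k n : ℕ} (hkn : k + n ≤ P.m + P.K) (c : PBond P (k + n)) :
    GaugeField.gaugeAct (frB7 P N k n 1) (iterFrom (avgB7 P N) k n (1 : GaugeField P k (Matrix.unitaryGroup (Fin N) ℂ))) c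
      = 1 := by
  apply Unitary.toUnits_injective
  rw [toUnits_framed hkn (one_mem_dom k), liftCfg_one, map_one, ← expCfg_zero]
  exact Units.ext (dbavgIter_one P.L (two_le_L P) n _ _)

/-! ## §5 Clause (ii): the one-bond Lipschitz bound, transported from `ℤ^d` -/

/-- The invariant bond distance of `U(N)` in the operator-norm model is the norm of the difference: `|g⁻¹h − 1| = ‖h − g‖` (unitaries are isometries; Mathlib `CStarRing.norm_mem_unitary_mul`). [cite: Balaban1985Averaging, (19) p.21] -/
theorem bdist_eq_norm_sub (g h : Matrix.unitaryGroup (Fin N) ℂ) : bdist g h = ‖(h : Mat N) - (g : Mat N)‖ := by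
  letI : CStarAlgebra (Mat N) := {}
  rw [bdist_def]
  change ‖((g⁻¹ * h : Matrix.unitaryGroup (Fin N) ℂ) : Mat N) - 1‖ = _
  rw [Submonoid.coe_mul, ← Unitary.star_eq_inv, Unitary.coe_star]
  have h1 : star (g : Mat N) * (h : Mat N) - 1 = star (g : Mat N) * ((h : Mat N) - (g : Mat N)) := by
    rw [mul_sub, Unitary.coe_star_mul_self]
  rw [h1, CStarRing.norm_mem_unitary_mul _ (Unitary.star_mem g.2)]

/-- `L^n·(L^n)^{−d} = θ^n`, `θ = L·L^{−d} = L^{1−d}` (file 10's `theta`). [folklore] -/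
theorem rate_eq (n : ℕ) : (P.L : ℝ) ^ n * (((P.L : ℝ) ^ n) ^ P.d)⁻¹ = theta P ^ n := by
  rw [theta, mul_pow, inv_pow, ← pow_mul, ← pow_mul, mul_comm P.d n]

/-- `K5(d,L,b,n) = C₃(L^n)²(L^n)^{−d}b ≤ θⁿ` under `C₃L^nb ≤ 1`. [folklore] -/
theorem K5_le {b : ℝ} {n : ℕ} (hn : C3 P.d P.L * ((P.L : ℝ) ^ n * b) ≤ 1) :
    K5 P.d P.L b n ≤ theta P ^ n := by
  rw [← rate_eq]
  have hpos : 0 ≤ (P.L : ℝ) ^ n * (((P.L : ℝ) ^ n) ^ P.d)⁻¹ := by positivity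
  calc K5 P.d P.L b n = (C3 P.d P.L * ((P.L : ℝ) ^ n * b)) * ((P.L : ℝ) ^ n * (((P.L : ℝ) ^ n) ^ P.d)⁻¹) := by
        rw [K5]; ring
    _ ≤ 1 * ((P.L : ℝ) ^ n * (((P.L : ℝ) ^ n) ^ P.d)⁻¹) := mul_le_mul_of_nonneg_right hn hpos
    _ = _ := one_mul _
set_option maxHeartbeats 400000 in
/-- **CLAUSE (ii) OF `FramedBondLip` FOR `avgB7`**: for `V, V′` in the level-`k` domain differing at ONE torus bond `b₀`, every framed
coarse bond variable moves by at most `4e·θⁿ·bdist(V_{b₀}, V′_{b₀})`, `θ = L^{1−d}` — b07's (156) integrated (file 14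
`norm_dbavgIter_sub_le_one_bond`) plus locality: of the periodic family of lifts of `b₀` AT MOST ONE lies in the box
`B^n(c₋) ∪ B^n(c₊)` (side `≤ 2L^n ≤ T_k`). [cite: Balaban1985Averaging, Prop. 5 (156) p.42, (137)–(138) p.39] -/
theorem framed_lip {k n : ℕ} (hkn : k + n ≤ P.m + P.K) {V V' : GaugeField P k (Matrix.unitaryGroup (Fin N) ℂ)}
    (hV : V ∈ dom P N k) (hV' : V' ∈ dom P N k) (b₀ : PBond P k) (hagree : ∀ b', b' ≠ b₀ → V b' = V' b')
    (c : PBond P (k + n)) :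
    bdist (GaugeField.gaugeAct (frB7 P N k n V) (iterFrom (avgB7 P N) k n V) c)
        (GaugeField.gaugeAct (frB7 P N k n V') (iterFrom (avgB7 P N) k n V') c)
      ≤ 4 * Real.exp 1 * theta P ^ n * bdist (V b₀) (V' b₀) := by
  letI : CStarAlgebra (Mat N) := {}
  have hL := two_le_L P
  have hL1 : 1 ≤ P.L := P.L_pos
  have hρ := rho_pos P k
  have hb : 0 ≤ 2 * rho P k := by linarith
  have hsm := C3_smallness (P := P) hkn
  obtain ⟨hc4, -⟩ := smallness_of_C3 P.L hL1 hb n hsm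
  set B := logCfg V with hBdef
  set B' := logCfg V' with hB'def
  have hB : ∀ x κ, ‖B x κ‖ ≤ 2 * rho P k := norm_logCfg_le hV
  have hB' : ∀ x κ, ‖B' x κ‖ ≤ 2 * rho P k := norm_logCfg_le hV'
  set z := tlift c.src with hzdef
  set κ := c.dir with hκdef
  -- the two framed bond variables, as matrices
  have hD : ((GaugeField.gaugeAct (frB7 P N k n V) (iterFrom (avgB7 P N) k n V) c : Matrix.unitaryGroup (Fin N) ℂ) : Mat N)
      = ((dbavgIter P.L (expCfg B) n z κ : (Mat N)ˣ) : Mat N) := by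
    have h := congrArg Units.val (toUnits_framed hkn hV c)
    rw [← expCfg_logCfg hV] at h
    exact h
  have hD' : ((GaugeField.gaugeAct (frB7 P N k n V') (iterFrom (avgB7 P N) k n V') c : Matrix.unitaryGroup (Fin N) ℂ) : Mat N)
      = ((dbavgIter P.L (expCfg B') n z κ : (Mat N)ˣ) : Mat N) := by
    have h := congrArg Units.val (toUnits_framed hkn hV' c)
    rw [← expCfg_logCfg hV'] at h
    exact h
  rw [bdist_eq_norm_sub, bdist_eq_norm_sub, hD, hD']
  -- the lifts agree off the periodic family of `b₀`
  have hagreeZ : ∀ x μ, ¬(tcls (per P k) x = b₀.src ∧ μ = b₀.dir) → B x μ = B' x μ := by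
    intro x μ hx
    have hne : (⟨tcls (per P k) x, μ⟩ : PBond P k) ≠ b₀ := by
      rintro rfl; exact hx ⟨rfl, rfl⟩
    simp only [hBdef, hB'def, logCfg, liftCfg, hagree _ hne]
  have hRHS : 0 ≤ 4 * Real.exp 1 * theta P ^ n * ‖((V' b₀ : Matrix.unitaryGroup (Fin N) ℂ) : Mat N) - (V b₀ : Mat N)‖ := by
    have := theta_nonneg P; positivity
  -- width of the box `B^n(c₋) ∪ B^n(c₊)` against the period
  have hwidth : ∀ i, B7Prop1Local.bondHiK P.L n z κ i - B7Prop1Local.loK P.L n z i < (per P k : ℤ) := by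
    intro i
    rw [per_add hkn]
    have h2 : (2 : ℤ) ≤ per P (k + n) := by
      simp only [per, Params.sitesPerDir]; have := pow_pos P.L_pos (P.m + P.K - (k + n)); push_cast; nlinarith
    have hLn : (0 : ℤ) < (P.L : ℤ) ^ n := by positivity
    simp only [B7Prop1Local.bondHiK, B7Prop1Local.loK]
    push_cast
    split_ifs <;> nlinarith
  by_cases hex : ∃ x₁ : Fin P.d → ℤ, tcls (per P k) x₁ = b₀.src ∧
      BondIn (B7Prop1Local.loK P.L n z) (B7Prop1Local.bondHiK P.L n z κ) x₁ b₀.dir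
  · obtain ⟨x₁, hx₁, hin⟩ := hex
    -- the intermediate configuration: `B` with the ONE lift of `b₀` inside the box switched to `B′`
    let B'' : (Fin P.d → ℤ) → Fin P.d → Mat N := fun x μ => if x = x₁ ∧ μ = b₀.dir then B' x μ else B x μ
    have hB'' : ∀ x μ, ‖B'' x μ‖ ≤ 2 * rho P k := fun x μ => by
      simp only [B'']; split_ifs; exacts [hB' x μ, hB x μ]
    have hagree1 : ∀ x μ, ¬(x = x₁ ∧ μ = b₀.dir) → B x μ = B'' x μ := fun x μ h => by simp only [B'', if_neg h]
    have hagree2 : AgreeOn (B7Prop1Local.loK P.L n z) (B7Prop1Local.bondHiK P.L n z κ) B'' B' := by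
      intro x μ hx hxe
      by_cases h : x = x₁ ∧ μ = b₀.dir
      · simp only [B'', if_pos h]
      · simp only [B'', if_neg h]
        refine hagreeZ x μ fun hh => h ⟨?_, hh.2⟩
        exact eq_of_inBox_of_tcls_eq hx hin.1 hwidth (by rw [hh.1, hx₁])
    have h14 := norm_dbavgIter_sub_le_one_bond P.L hL B B'' hb hB hB'' n hsm x₁ b₀.dir hagree1 z κ
    have hval : ∀ {B₀ : (Fin P.d → ℤ) → Fin P.d → Mat N}, (∀ x μ, ‖B₀ x μ‖ ≤ 2 * rho P k) →
        dbavgIter P.L (expCfg B₀) n z κ = B7Prop1Explicit.expUnit (logIter P.L B₀ n z κ) := fun hB₀ => by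
      rw [dbavgIter_eq_expCfg_logIter P.L hL _ hb hB₀ n hc4 le_rfl]; rfl
    have hD''eq : dbavgIter P.L (expCfg B'') n z κ = dbavgIter P.L (expCfg B') n z κ := by
      rw [hval hB'', hval hB', logIter_congr P.L hL1 n z κ hagree2]
    rw [← hD''eq]
    refine h14.trans ?_
    have hx₁val : B'' x₁ b₀.dir - B x₁ b₀.dir
        = mlog ((V' b₀ : Matrix.unitaryGroup (Fin N) ℂ) : Mat N) - mlog ((V b₀ : Matrix.unitaryGroup (Fin N) ℂ) : Mat N) := by
      have hb0 : (⟨tcls (per P k) x₁, b₀.dir⟩ : PBond P k) = b₀ := by rw [hx₁]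
      simp only [B'', if_pos (And.intro rfl rfl), hBdef, hB'def, logCfg, val_liftCfg, hb0]
    have hlog : ‖B'' x₁ b₀.dir - B x₁ b₀.dir‖
        ≤ 2 * ‖((V' b₀ : Matrix.unitaryGroup (Fin N) ℂ) : Mat N) - (V b₀ : Mat N)‖ := by
      rw [hx₁val]
      have h := FederbushMean.norm_mlog_sub_mlog_le (ρ := 1 / 2) (by norm_num)
        ((hV' b₀).trans (rho_le_half P k)) ((hV b₀).trans (rho_le_half P k))
      norm_num at h
      exact h
    have hK := K5_le (P := P) hsm
    have hθ : 0 ≤ theta P ^ n := pow_nonneg (theta_nonneg P) n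
    have hnn : 0 ≤ ‖((V' b₀ : Matrix.unitaryGroup (Fin N) ℂ) : Mat N) - (V b₀ : Mat N)‖ := norm_nonneg _
    rw [rate_eq] at *
    calc Real.exp 1 * ((theta P ^ n + K5 P.d P.L (2 * rho P k) n) * ‖B'' x₁ b₀.dir - B x₁ b₀.dir‖)
        ≤ Real.exp 1 * ((theta P ^ n + theta P ^ n) * (2 * ‖((V' b₀ : Matrix.unitaryGroup (Fin N) ℂ) : Mat N) - (V b₀ : Mat N)‖)) := by
          gcongr
      _ = 4 * Real.exp 1 * theta P ^ n * ‖((V' b₀ : Matrix.unitaryGroup (Fin N) ℂ) : Mat N) - (V b₀ : Mat N)‖ := by ring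
  · -- no lift of `b₀` inside the box: the two iterates agree at `c`
    have hagree2 : AgreeOn (B7Prop1Local.loK P.L n z) (B7Prop1Local.bondHiK P.L n z κ) B B' := by
      intro x μ hx hxe
      refine hagreeZ x μ fun hh => hex ⟨x, hh.1, ?_⟩
      rw [← hh.2]; exact ⟨hx, hxe⟩
    have hval : ∀ {B₀ : (Fin P.d → ℤ) → Fin P.d → Mat N}, (∀ x μ, ‖B₀ x μ‖ ≤ 2 * rho P k) →
        dbavgIter P.L (expCfg B₀) n z κ = B7Prop1Explicit.expUnit (logIter P.L B₀ n z κ) := fun hB₀ => by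
      rw [dbavgIter_eq_expCfg_logIter P.L hL _ hb hB₀ n hc4 le_rfl]; rfl
    have hDeq : dbavgIter P.L (expCfg B) n z κ = dbavgIter P.L (expCfg B') n z κ := by
      rw [hval hB, hval hB', logIter_congr P.L hL1 n z κ hagree2]
    rw [hDeq, sub_self, norm_zero]
    exact hRHS

/-! ## §6 `FramedBondLip` for Bałaban's (15) on the torus, and NODE S's input chain -/

/-- **`FramedBondLip (avgB7 P N) dom (4e) θ`, `θ = L^{1−d}`** — the framed one-bond Lipschitz bound (file 12's shape) for the
torus realisation of [Balaban1985Averaging] (15), from the KERNEL-PROVED per-entry bound Prop. 5 (156) at `U₀ = 1` (b07's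
`B7Prop5Flat`, integrated in file 14) through the dictionary of files 17–19. [cite: Balaban1985Averaging, Prop. 5 (156) p.42] -/
theorem framedBondLip_avgB7 : FramedBondLip (avgB7 P N) (dom P N) (4 * Real.exp 1) (theta P) :=
  fun k n hkn => ⟨frB7 P N k n, fun c => framed_one hkn c,
    fun _ _ hV hV' b₀ hagree c => framed_lip hkn hV hV' b₀ hagree c⟩

/-- **`BondDevBound (avgB7 P N) dom (4e) θ`** (file 12's telescoping over the fibre-convex sup-ball domain). [folklore] -/
theorem bondDevBound_avgB7 : BondDevBound (avgB7 P N) (dom P N) (4 * Real.exp 1) (theta P) :=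
  bondDevBound_of_framedBondLip fibreConvex_dom framedBondLip_avgB7

/-- **`HolDevBound (avgB7 P N) dom (4e) θ`** — NODE S's per-holonomy input (file 8) for Bałaban's (15) on the torus. [folklore] -/
theorem holDevBound_avgB7 : HolDevBound (avgB7 P N) (dom P N) (4 * Real.exp 1) (theta P) :=
  holDevBound_of_framedBondLip fibreConvex_dom framedBondLip_avgB7

/-- **`LoopDefectBound (avgB7 P N) dom (8e²) θ`** — NODE S's loop-defect bound (file 5) for Bałaban's (15) on the torus, by
criticality of `Re tr` on `U(N)` (`reTrCrit_unitaryGroup`, `Cc = 1/2`): `0 ≤ 1 − W(avgⁿ V) ≤ 8e²·(|w|·tv(1,V)·θⁿ)²`. [folklore] -/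
theorem loopDefectBound_avgB7 : LoopDefectBound (avgB7 P N) (dom P N) (1 / 2 * (4 * Real.exp 1) ^ 2) (theta P) :=
  loopDefectBound_of_holDevBound reTrCrit_unitaryGroup (by norm_num) holDevBound_avgB7

/-! ## §7 The end-to-end statement NODE S consumes, for Bałaban's (15) on the torus -/

/-- **NODE S's CHAIN END TO END FOR BAŁABAN'S (15) ON THE TORUS** (the twin of file 10's `abs_log_quotient_sub_le_linAvg`, now for
the genuine non-abelian block averaging): for ANY two probability laws `ν₁, ν₂` on level-`k` configurations taking values in the
small-field domain, supported (≠ 1) on a finite bond set `Λ` with one-bond deviations `≤ D`, every closed walk `w` of the coarse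
torus `T^{(k+n)}` and every source strength `t`, the `t`-tilted log-quotient of the loop observable of the `n`-fold average obeys
`|log ∫e^{t(W−1)}dν₁ − log ∫e^{t(W−1)}dν₂| ≤ 2|t|·8e²·(|w|·|Λ|·D)²·(θ²)ⁿ`, `θ = L^{1−d}` — criticality (file 5) ∘ `loopDefectBound_avgB7`
∘ `loopDefect_le_of_support` ∘ `abs_log_integral_exp_sub_le`.  No property of the laws beyond the support is used: this is the
(QL-a)∣_{U=1} mechanism with every averaging-side input PROVED; what NODE S still takes from elsewhere is the FORMAT (W-fmt@1: that the
two runs' constants are such log-quotients — NODE O) and the (0.26) census of `Λ`. [folklore] -/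
theorem abs_log_quotient_sub_le_avgB7 {Ω : Type*} [MeasurableSpace Ω] (ν₁ ν₂ : MeasureTheory.Measure Ω)
    [MeasureTheory.IsProbabilityMeasure ν₁] [MeasureTheory.IsProbabilityMeasure ν₂] {k n : ℕ} (hn : k + n ≤ P.m + P.K)
    (x : Site P (k + n)) (w : List (T4Continuum.Letter P.d)) (hw : walkEnd x w = x)
    (cfg : Ω → GaugeField P k (Matrix.unitaryGroup (Fin N) ℂ)) (hdom : ∀ ω, cfg ω ∈ dom P N k)
    (Λ : Finset (PBond P k)) {D : ℝ} (hoff : ∀ ω b, b ∉ Λ → cfg ω b = 1) (hD : ∀ ω, ∀ b ∈ Λ, dist1 (cfg ω b) ≤ D)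
    (hG₁ : MeasureTheory.AEStronglyMeasurable (fun ω => loopAt (iterFrom (avgB7 P N) k n (cfg ω)) (walk x w) - 1) ν₁)
    (hG₂ : MeasureTheory.AEStronglyMeasurable (fun ω => loopAt (iterFrom (avgB7 P N) k n (cfg ω)) (walk x w) - 1) ν₂)
    (t : ℝ) :
    |Real.log (∫ ω, Real.exp (t * (loopAt (iterFrom (avgB7 P N) k n (cfg ω)) (walk x w) - 1)) ∂ν₁)
      - Real.log (∫ ω, Real.exp (t * (loopAt (iterFrom (avgB7 P N) k n (cfg ω)) (walk x w) - 1)) ∂ν₂)|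
      ≤ 2 * (|t| * (1 / 2 * (4 * Real.exp 1) ^ 2 * ((w.length : ℝ) * Λ.card * D) ^ 2 * (theta P ^ 2) ^ n)) := by
  have key : ∀ ω, |loopAt (iterFrom (avgB7 P N) k n (cfg ω)) (walk x w) - 1|
      ≤ 1 / 2 * (4 * Real.exp 1) ^ 2 * ((w.length : ℝ) * Λ.card * D) ^ 2 * (theta P ^ 2) ^ n := fun ω => by
    have h := loopDefect_le_of_support loopDefectBound_avgB7 (by positivity) (theta_nonneg P) hn x w hw (cfg ω)
      (hdom ω) (one_mem_dom k) Λ (fun b hb => hoff ω b hb) (hD ω)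
    have h0 := loopDefect_nonneg (iterFrom (avgB7 P N) k n (cfg ω)) (walk x w)
    rw [abs_le]
    constructor <;> linarith
  exact abs_log_integral_exp_sub_le ν₁ ν₂ hG₁ hG₂ (MeasureTheory.ae_of_all _ key) (MeasureTheory.ae_of_all _ key) t

end Summit.QuantumFields.BalabanUV.T4Continuum.Spine.NE7.TorusB7

end
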